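import Summits.Ventures.Crystal3D.StickySpheres.SmallContactValues
import Summits.Ventures.Crystal3D.StickySpheres.Witnesses
import Mathlib.Tactic.IntervalCases
import HarnessLib

/-!
# The small contact-number table `C(4..13) = 6, 9, 12, 15, 18, 21, 25, 29, 33, 36`, conditional
# exactly on the census strata (minimum-degree form)

HONEST FRAMING. Part of the venture `Summits/Ventures/Crystal3D` (cell `pub-crystal3d`, PLAN R15/R17,
`paper/REDUCTIONS.md` Lemmas R2/R5). This file PROVES:

* unconditionally: nothing new about `C(n)` beyond what the tree has (`C(4) = 6`, `C(5) = 9` —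
  seat p2 —, `C(6) = 12` — `RadiusOne.lean` via the tree's six-ball enumeration —, and the
  witnesses `C(7..13) ≥ 15, 18, 21, 25, 29, 33, 36`);
* the INDUCTION SCHEMA with a size-dependent minimum degree (`maxContacts_eq_of_stratumMinDeg`):
  if `C(n₁) = t n₁` and for `n₁ < n ≤ n₂` one has witnesses `t n ≤ C(n)`, the arithmetic
  `t (n-1) + d n ≤ t n + 1`, and the stratum statement `S_{d n}(t n, n)` ("every packing of `n`
  balls all of whose balls have `≥ d n` contacts has `≤ t n` contacts" — exactly what a certified
  non-realisability sweep of the graphs with minimum degree `≥ d n` and `> t n` edges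
  establishes), then `C(n) = t n` throughout (a ball of degree `< d n` is removed at a loss
  `≤ d n - 1 ≤ t n - t (n-1)`);
* its instance for the printed table: `maxContacts_eq_contactTable` — for `4 ≤ n ≤ 13`,
  `C(n) = contactTable n` CONDITIONAL on the seven strata `S_4(15,7)`, `S_4(18,8)`, `S_4(21,9)`,
  `S_5(25,10)`, `S_5(29,11)`, `S_5(33,12)`, `S_4(36,13)` (minimum degrees `d_n = t n - t (n-1) + 1`
  as in REDUCTIONS R2), with the individual rows `maxContacts_three_ten_of_strata` etc.

The strata are HYPOTHESES (`StratumHypothesisMinDeg d t n`, a `Prop` over packings) to be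
discharged by the cell's two-engine certified census; nothing here asserts them. The values
`25, 29, 33` (`n = 10, 11, 12`) and `36` (`n = 13`) are those reported by Arkus–Manoharan–Brenner
2011, Hoy et al. 2012 and Holmes-Cerfon 2016 and quoted by Bezdek 2013 with the caveat "the status
of the mathematical rigour … remains to be seen"; Bezdek–Khan 2018: "`c(n,3)` is still unknown for
`n ≥ 6`". No crystallization statement is claimed.
-/

noncomputable section

open Finset

namespace Summit.Ventures.Crystal3D

/-! ## Strata with a prescribed minimum degree -/

/-- **Stratum hypothesis with minimum degree `d`**, `S_d(t, n)`: every unit packing of `n` balls in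
`ℝ³` all of whose balls have at least `d` contacts has at most `t` contacts. (`S_3 = ` seat p2's
`StratumHypothesis`.) A hypothesis, discharged by certified enumeration. -/
def StratumHypothesisMinDeg (d t n : ℕ) : Prop :=
  ∀ x : Fin n → EuclideanSpace ℝ (Fin 3), IsUnitPacking x → (∀ i, d ≤ coordination x i) →
    numContacts x ≤ t

/-- `S_3(t, n)` is literally `StratumHypothesis t n`. -/
theorem stratumHypothesisMinDeg_three_iff (t n : ℕ) :
    StratumHypothesisMinDeg 3 t n ↔ StratumHypothesis t n :=
  Iff.rfl

/-- A stratum statement with a SMALLER minimum degree is stronger: `S_d ⇒ S_{d'}` for `d ≤ d'`. -/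
theorem StratumHypothesisMinDeg.mono {d d' t n : ℕ} (h : d ≤ d') (hS : StratumHypothesisMinDeg d t n) :
    StratumHypothesisMinDeg d' t n :=
  fun x hx hd => hS x hx fun i => h.trans (hd i)

/-- **Induction with size-dependent minimum degree.** Let `t d : ℕ → ℕ`, `n₁ ≤ n₂`, `C(n₁) = t n₁`,
and for every `n₁ < n ≤ n₂`: `t (n-1) + d n ≤ t n + 1` (removing a ball of degree `< d n` cannot
beat the table), `t n ≤ C(n)` (a witness) and `S_{d n}(t n, n)` (the sweep). Then `C(n) = t n`
for all `n₁ ≤ n ≤ n₂`. -/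
theorem maxContacts_eq_of_stratumMinDeg (t d : ℕ → ℕ) {n₁ n₂ : ℕ}
    (hbase : maxContacts 3 n₁ = t n₁)
    (hstep : ∀ n, n₁ < n → n ≤ n₂ → t (n - 1) + d n ≤ t n + 1)
    (hwit : ∀ n, n₁ < n → n ≤ n₂ → t n ≤ maxContacts 3 n)
    (hS : ∀ n, n₁ < n → n ≤ n₂ → StratumHypothesisMinDeg (d n) (t n) n) :
    ∀ n, n₁ ≤ n → n ≤ n₂ → maxContacts 3 n = t n := by
  intro n hn1 hn2
  induction n using Nat.strong_induction_on with
  | _ n ih =>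
    rcases eq_or_lt_of_le hn1 with rfl | hlt
    · exact hbase
    · obtain ⟨m, rfl⟩ : ∃ m, n = m + 1 := ⟨n - 1, by omega⟩
      have ihC : maxContacts 3 m = t m := ih m (by omega) (by omega) (by omega)
      have hst := hstep (m + 1) hlt hn2
      simp only [Nat.add_sub_cancel] at hst
      have hw := hwit (m + 1) hlt hn2
      refine le_antisymm ?_ hw
      obtain ⟨x, hx, hxe⟩ := exists_numContacts_eq_maxContacts (by norm_num : 0 < 3) (m + 1)
      rw [← hxe]
      by_cases hall : ∀ i, d (m + 1) ≤ coordination x i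
      · exact hS (m + 1) hlt hn2 x hx hall
      · obtain ⟨i, hi⟩ := not_forall.1 hall
        have hlt' : coordination x i < d (m + 1) := not_le.1 hi
        have h1 := numContacts_le_add_maxContacts hx (Nat.le_sub_one_of_lt hlt')
        rw [ihC] at h1
        omega

/-! ## The printed table -/

/-- The printed small contact numbers: `3n - 6` for `n ≤ 9`, then `25, 29, 33, 36` for
`n = 10, 11, 12, 13` (junk `0` beyond `13`, never used). -/
def contactTable (n : ℕ) : ℕ :=
  if n ≤ 9 then 3 * n - 6
  else if n = 10 then 25 else if n = 11 then 29 else if n = 12 then 33 else if n = 13 then 36 else 0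

/-- The minimum degrees `d_n = c_n - c_{n-1} + 1` of REDUCTIONS R2: `4` for `n ≤ 9` and `n = 13`,
`5` for `n = 10, 11, 12`. -/
def minDegTable (n : ℕ) : ℕ :=
  if n ≤ 9 then 4 else if n = 13 then 4 else 5

/-- The witnesses `contactTable n ≤ C(n)` for `7 ≤ n ≤ 13` (tree constructions). -/
theorem contactTable_le_maxContacts {n : ℕ} (h7 : 7 ≤ n) (h13 : n ≤ 13) :
    contactTable n ≤ maxContacts 3 n := by
  interval_cases n
  · exact le_maxContacts_seven_eight_nine.1
  · exact le_maxContacts_seven_eight_nine.2.1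
  · exact le_maxContacts_seven_eight_nine.2.2
  · exact twentyFive_le_maxContacts_ten
  · exact twentyNine_le_maxContacts_eleven
  · exact thirtyThree_le_maxContacts_twelve
  · exact thirtySix_le_maxContacts_thirteen

/-- **The table, conditional on the seven strata.** If `S_{d_n}(c_n, n)` holds for `n = 7, …, 13`
(`d_n`, `c_n` from `minDegTable`, `contactTable`), then `C(n) = contactTable n` for every
`4 ≤ n ≤ 13`. The rows `n = 4, 5, 6` are unconditional tree theorems. -/
theorem maxContacts_eq_contactTable
    (hS : ∀ n, 7 ≤ n → n ≤ 13 → StratumHypothesisMinDeg (minDegTable n) (contactTable n) n)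
    {n : ℕ} (h4 : 4 ≤ n) (h13 : n ≤ 13) : maxContacts 3 n = contactTable n := by
  rcases Nat.lt_or_ge n 6 with hlt | h6
  · interval_cases n
    · simpa [contactTable] using maxContacts_three_four
    · simpa [contactTable] using maxContacts_three_five
  · refine maxContacts_eq_of_stratumMinDeg contactTable minDegTable (n₁ := 6) (n₂ := 13)
      (by simpa [contactTable] using maxContacts_three_six) ?_ ?_ ?_ n h6 h13
    · intro n hn hn13
      interval_cases n <;> simp [contactTable, minDegTable]
    · intro n hn hn13
      exact contactTable_le_maxContacts (by omega) hn13
    · intro n hn hn13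
      exact hS n (by omega) hn13

/-- **Row `n = 10`**: `C(10) = 25` from the four strata `S_4(15,7)`, `S_4(18,8)`, `S_4(21,9)`,
`S_5(25,10)`. -/
theorem maxContacts_three_ten_of_strata (h7 : StratumHypothesisMinDeg 4 15 7)
    (h8 : StratumHypothesisMinDeg 4 18 8) (h9 : StratumHypothesisMinDeg 4 21 9)
    (h10 : StratumHypothesisMinDeg 5 25 10) : maxContacts 3 10 = 25 := by
  have h := maxContacts_eq_of_stratumMinDeg contactTable minDegTable (n₁ := 6) (n₂ := 10)
    (by simpa [contactTable] using maxContacts_three_six)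
    (by intro n hn hn'; interval_cases n <;> simp [contactTable, minDegTable])
    (fun n hn hn' => contactTable_le_maxContacts (by omega) (by omega))
    (by
      intro n hn hn'
      interval_cases n <;> simpa [contactTable, minDegTable])
    10 (by norm_num) le_rfl
  simpa [contactTable] using h

/-- **Rows `n ≤ 9`**: `C(n) = 3n - 6` for `4 ≤ n ≤ 9` from the three strata `S_4(15,7)`,
`S_4(18,8)`, `S_4(21,9)` (minimum degree FOUR suffices, one more than seat p2's `S_3` form). -/
theorem maxContacts_eq_three_mul_sub_six_of_strata (h7 : StratumHypothesisMinDeg 4 15 7)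
    (h8 : StratumHypothesisMinDeg 4 18 8) (h9 : StratumHypothesisMinDeg 4 21 9)
    {n : ℕ} (h4 : 4 ≤ n) (h9' : n ≤ 9) : maxContacts 3 n = 3 * n - 6 := by
  rcases Nat.lt_or_ge n 6 with hlt | h6
  · interval_cases n
    · simpa using maxContacts_three_four
    · simpa using maxContacts_three_five
  · have h := maxContacts_eq_of_stratumMinDeg contactTable minDegTable (n₁ := 6) (n₂ := 9)
      (by simpa [contactTable] using maxContacts_three_six)
      (by intro n hn hn'; interval_cases n <;> simp [contactTable, minDegTable])
      (fun n hn hn' => contactTable_le_maxContacts (by omega) (by omega))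
      (by
        intro n hn hn'
        interval_cases n <;> simpa [contactTable, minDegTable])
      n h6 h9'
    have hn : n ≤ 9 := h9'
    simpa [contactTable, hn] using h

end Summit.Ventures.Crystal3D

end
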